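import Literature.MathematicalPhysics.QuantumFieldTheory.Balaban1983to89.Node00.TorusCoverCubeDomains
import Literature.MathematicalPhysics.QuantumFieldTheory.Balaban1983to89.Node00.DomainsMeet
import Literature.MathematicalPhysics.QuantumFieldTheory.Balaban1983to89.Node00.Sect2FrameOfRecord
import Literature.MathematicalPhysics.QuantumFieldTheory.BalabanImbrieJaffe1984to88.BIJ85ContourLocality
import HarnessLib

/-!
# N07 [B11] (= [15] = [Balaban1985Variational]) Sect. F — **THE FAR DATUM ROWS OF THE CHART ((152) READ THROUGH (156)–(157)) FROM THE TOWER LETTERS ALONE**: for a cell `c` of level `j ≥ 1` whose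
# endpoint labels lie in the one-collar label box `[sqLo j − 1, sqHi j + 1]` of the cube `□_j^{(j)}` of the (1.131) tower (every `Λ_j`-cell of print's (150) family does), the
# block mean `(Q_jA)(c) = bondAvgIter j A c` reads fine bonds under `□_{j−1}` only, so (152)'s letter on `□_{j−1}` bounds it: `‖(Q_jA)(c)‖ ≤ t_{j−1}`; with the S3 door's
# level-weighted letters `t_{j′} = κ·ε·L^{k−j′}` this is the plain block average of print's (156)–(157) datum in the unit `η_k` (print's `B` is `L^{j}η` times it, uniform: (155)) —
# the supplier of HCHART-MEET-NORM's far row in MODULE 77b's weighted shape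

Cell `pub-ymgap`, seat `pub-ymgap-dag-n07-e` g26 (FAN-OUT §N07 row s3; LANE OWNER of the K0 road), MODULE 78 (INTENT-78, cell bus).  `--kind proof --supports stmt-QuantumFields-20541 --as helper`
(K0⁷); count-neutral; def-free.  [15] = [Balaban1985Variational]; [6] = [Balaban1985RegularSpaces]; [4] = [Balaban1984PropagatorsI]; [I] = [Balaban1987RG1].

WHY.  Print pp. 301–302: on the far cells `Λ′_j`, `j < k`, the chart's datum is the block average of `A` ((156) `Q_j(ηA) = B`, (157) `L^{j}η·Q_jA′ = B`; with (152) `L^{j}η|A| < 9dL²B₁Mε₀`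
print's `B` is uniform `O(Mε₀)` in the coarse unit, (155)); the PLAIN average `(Q_jA)(c)` in the top-level unit is `(L^{j}η)⁻¹ = L^{k−j}` times larger (ref-G g31 units note).  In the tree the S3 door (HS3NORM-67c, rows (T1)∕(T2))
displays `‖A b‖ < κ·ε·L^{k−j′}` for the fine bonds `b` under `□_{j′}` (`Sect2.regionOfSet (cover '' cube L a M ρ k j′)`), `j′ ≤ k`; the chart's far row (MODULE 77b, print's weight restored)
asks `‖B c‖ ≤ β₂·(ρ + M)·L^{k − j(c)}`.  The bridge is bookkeeping: a level-`j` cell `c = ⟨y, y + e_μ⟩` with ONE endpoint in `□_j^{(j)}` (print's `Λ_j ⊂ □_j`, [4] (2.3); the other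
endpoint is a neighbour) has both labels in `[sqLo j − 1, sqHi j + 1]`; the fine bonds feeding `(Q_jA)(c)` lie under the two `L^j`-blocks of its endpoints ([4] (1.18)), and those blocks
lie in `□_{j−1}` because the collar between `□_j` and `□_{j−1}` is `ρ ≥ L` blocks of level `j − 1` ([6] p. 98 «a distance between boundaries of these cubes is equal to `R₁M₁Lʲη`»;
`sqLo (j−1) = L·sqLo j − ρ`, `sqHi (j−1) = L·sqHi j + (L − 1) + ρ`).  Hence `‖(Q_jA)(c)‖ ≤ sup {‖A b‖ : b under □_{j−1}}` (a mean: `BIJ85ContourLocality.norm_bondAvgIter_le_tower`).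

WHAT IS PROVED (sorry-free; no definition; axioms standard; `P : Params` generic, values in any real normed space `W`, e.g. `M_N(ℂ)`).
§1 `sqLo_pred_apply` ∕ `sqHi_pred_apply` (the tower's labels one level down, `B8Eq131Cubes.gs_succ`), ★ `inBox_pred_of_blockMap_collar` (a level-`(j−1)` label under a collar label of
   `□_j^{(j)}` is a label of `□_{j−1}^{(j−1)}`, `L ≤ ρ`), ★ `blockSites_collar_subset_cube_pred` (the `L^j`-block of a collar label lies in `□_{j−1}`).
§2 `coverAt_add_single` (`π_j (s + e_μ) = (π_j s) + e_μ`), ★ `mem_image_cover_cube_pred_of_iterBlockOf_eq` (a fine torus site whose `j`-fold block is `π_j s`, `s` a collar label, is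
   covered by `□_{j−1}`), ★ `exists_collar_labels_of_lamBond_meet` (every `Λ_j`-cell, `1 ≤ j ≤ k`, of the levelwise meet `cubeDomains ⊓ D₂` has both endpoint labels in the collar box).
§3 ★★ `norm_bondAvgIter_le_of_letter_cube_pred` (the header's bound for a cell with collar labels), ★★★ `norm_bondAvgIter_le_of_tower152_meet` (for every cell `c` of
   `cubeDomains ⊓ D₂` of level `1 ≤ j(c)`: the (T2) row of HS3NORM-67c VERBATIM ⇒ `‖bondAvgIter j(c) A c‖ ≤ κ·ε·L^{k − (j(c) − 1)}`), ★ `…_meet_weighted` (the same as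
   `≤ (κ·L·ε)·L^{k − j(c)}`, MODULE 77b's far-row shape with `β₂·(ρ + M) := κ·L·ε`, valid since `ρ + M ≥ 1` is not needed: stated with the bare weight).
HONEST SCOPE.  Lattice bookkeeping (means and boxes); (T2) is a HYPOTHESIS (HS3NORM-67c's displayed row, door CONDITIONAL on `HThm4Rec`); nothing of [15]∕[6]∕[4] ANALYSIS asserted; the
chart's assembly (154)–(159) is NOT done here (this is its far-row input; far PINNED cells beyond `□₀` take `B c := 0` by MODULE 76); K0⁷ ∕ K1⁹ NOT closed; N07 NOT discharged;
counts unmoved (typed 28∕28 · discharged 8∕27 per the chair); one finite 𝕋⁴ programme at fixed ε — the route closes the conditional finite-𝕋⁴ rung `BalabanLadder.UV` ONLY; the YM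
mass gap (Clay) is NOT proved by any of this; nothing continuum ∕ ℝ⁴ ∕ OS.  No `sorry`, no `def`, no `instance`, no `notation`.

References: [15] (150)–(152) p. 301, (155) p. 302, (157)–(159) pp. 302–303; [6] (1.131) pp. 98–99; [4] (1.11) p. 19, (1.18) p. 20, [Balaban1984PropagatorsII] (2.1)–(2.3) p. 224,
(2.20) p. 226; [I] (0.1) p. 251.
-/

set_option autoImplicit false

noncomputable section
open scoped BigOperators

namespace Summit.QuantumFields.YangMills.BalabanUVNodes.N07FarRowsOfTowerLetters

open Literature.MathematicalPhysics.QuantumFieldTheory.Balaban1983to89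
open Literature.MathematicalPhysics.QuantumFieldTheory.Balaban1983to89.Node00
open LatticeFieldCalculus (bondAvgIter)
open B15Eq112TorusCover (cover)
open B14DomainGeom (Pt)
open B5Eq118OneStroke (iterBlockOf iterBlock mem_iterBlock)
open B7Prop1Local (InBox)
open B8Eq131Cubes (cube sqLo sqHi gs gs_succ bLo bHi)
open B6SectADomainsV1 (Domains)
open B6SectAOperatorsV1 (BondIdx)
open Literature.MathematicalPhysics.QuantumLattice (blockMap blockSites mem_blockSites_iff)
open Literature.MathematicalPhysics.QuantumFieldTheory.BalabanImbrieJaffe1984to88.BIJ85ContourLocality (norm_bondAvgIter_le_tower)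
open Literature.MathematicalPhysics.QuantumFieldTheory.BalabanImbrieJaffe1984to88.BIJ85GaugeFunction5113 (blk)

variable {P : Params}

/-! ## §1  The labels of the (1.131) tower one level down; the collar label box under `□_{j−1}` -/

/-- `sqLo_{j−1} = L·sqLo_j − ρ` (`1 ≤ j ≤ k`): the lower label of `□_{j−1}^{(j−1)}` is the blow-down of `□_j`'s, minus the collar `ρ` ([6] p. 98 «a distance between boundaries of these cubes
is equal to `R₁M₁Lʲη`»). [cite: Balaban1985RegularSpaces, (1.131) p.99, p.98] -/
theorem sqLo_pred_apply {a : Pt P.d} {ρ k j : ℕ} (h1 : 1 ≤ j) (hjk : j ≤ k) (i : Fin P.d) :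
    sqLo P.L a ρ k (j - 1) i = (P.L : ℤ) * sqLo P.L a ρ k j i - ρ := by
  have hkj : k - (j - 1) = (k - j) + 1 := by omega
  simp only [sqLo, bLo, hkj, gs_succ, pow_succ]
  push_cast
  ring

/-- `sqHi_{j−1} = L·sqHi_j + (L − 1) + ρ` (`1 ≤ j ≤ k`). [cite: Balaban1985RegularSpaces, (1.131) p.99, p.98] -/
theorem sqHi_pred_apply {a : Pt P.d} {M ρ k j : ℕ} (h1 : 1 ≤ j) (hjk : j ≤ k) (i : Fin P.d) :
    sqHi P.L a M ρ k (j - 1) i = (P.L : ℤ) * sqHi P.L a M ρ k j i + ((P.L : ℤ) - 1) + ρ := by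
  have hkj : k - (j - 1) = (k - j) + 1 := by omega
  simp only [sqHi, bHi, hkj, gs_succ, pow_succ]
  push_cast
  ring

/-- Floor division by `L`: `L·⌊x∕L⌋ ≤ x ≤ L·⌊x∕L⌋ + (L − 1)` coordinatewise. [folklore] -/
theorem blockMap_mul_le_and_le (x : Pt P.d) (i : Fin P.d) :
    (P.L : ℤ) * blockMap P.L x i ≤ x i ∧ x i ≤ (P.L : ℤ) * blockMap P.L x i + ((P.L : ℤ) - 1) := by
  have hL : (0 : ℤ) < (P.L : ℤ) := by exact_mod_cast P.L_pos
  simp only [blockMap]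
  constructor
  · exact Int.mul_ediv_self_le hL.ne'
  · have := Int.lt_mul_ediv_self_add hL (x := x i)
    linarith

/-- ★ A level-`(j−1)` label `z` whose `L`-block label `⌊z∕L⌋` lies in the ONE-COLLAR label box `[sqLo_j − 1, sqHi_j + 1]` of `□_j^{(j)}` is a label of `□_{j−1}^{(j−1)}`, provided the collar is at
least one block: `L ≤ ρ`. [cite: Balaban1985RegularSpaces, (1.131) p.99, p.98] -/
theorem inBox_pred_of_blockMap_collar {a : Pt P.d} {M ρ k j : ℕ} (hLρ : P.L ≤ ρ) (h1 : 1 ≤ j) (hjk : j ≤ k) {z : Pt P.d}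
    (hz : InBox (sqLo P.L a ρ k j - 1) (sqHi P.L a M ρ k j + 1) (blockMap P.L z)) :
    InBox (sqLo P.L a ρ k (j - 1)) (sqHi P.L a M ρ k (j - 1)) z := by
  intro i
  obtain ⟨hlo, hhi⟩ := hz i
  obtain ⟨h1', h2'⟩ := blockMap_mul_le_and_le z i
  simp only [Pi.sub_apply, Pi.add_apply, Pi.one_apply] at hlo hhi
  have hLρ' : (P.L : ℤ) ≤ ρ := by exact_mod_cast hLρ
  have hL0 : (0 : ℤ) ≤ (P.L : ℤ) := by positivity
  rw [sqLo_pred_apply h1 hjk, sqHi_pred_apply h1 hjk]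
  constructor
  · have := mul_le_mul_of_nonneg_left hlo hL0
    nlinarith
  · have := mul_le_mul_of_nonneg_left hhi hL0
    nlinarith

/-- ★ **The `L^j`-block of a collar label lies in `□_{j−1}`** (`1 ≤ j ≤ k`, `L ≤ ρ`): for `s ∈ [sqLo_j − 1, sqHi_j + 1]`, `blockSites (L^j) s ⊆ □_{j−1}` as sets of fine points.
[cite: Balaban1985RegularSpaces, (1.131) p.99, p.98; Balaban1984PropagatorsI, (1.18) p.20] -/
theorem blockSites_collar_subset_cube_pred {a : Pt P.d} {M ρ k j : ℕ} (hLρ : P.L ≤ ρ) (h1 : 1 ≤ j) (hjk : j ≤ k) {s : Pt P.d}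
    (hs : InBox (sqLo P.L a ρ k j - 1) (sqHi P.L a M ρ k j + 1) s) :
    (↑(blockSites (P.L ^ j) s) : Set (Pt P.d)) ⊆ cube P.L a M ρ k (j - 1) := by
  haveI : NeZero (P.L ^ j) := ⟨(pow_pos P.L_pos j).ne'⟩
  intro x hx
  rw [Finset.mem_coe, mem_blockSites_iff] at hx
  refine mem_cube_of_blockMap_inBox (inBox_pred_of_blockMap_collar hLρ h1 hjk ?_)
  have hpow : P.L ^ (j - 1) * P.L = P.L ^ j := by rw [← pow_succ, Nat.sub_add_cancel h1]
  rw [blockMap_blockMap, hpow, hx]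
  exact hs

/-! ## §2  Fibres of collar labels under the cover; the cells of the meet family -/

/-- `π_j (s + e_μ) = (π_j s) + e_μ`: the level-`j` cover intertwines the unit steps (as n07-w3's `TorusCoverBlockAveragingZd.coverAt_add_e`, re-proved here to keep the imports small).
[cite: Balaban1987RG1, (0.1) p.251] -/
theorem coverAt_add_single (j : ℕ) (s : Pt P.d) (μ : Fin P.d) : coverAt P j (s + Pi.single μ 1) = (coverAt P j s).shift μ := by
  funext ν
  simp only [Site.shift, coverAt]
  by_cases h : ν = μ
  · subst h; simp
  · simp [Function.update_of_ne h, Pi.single_eq_of_ne h]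

/-- ★ **A fine torus site whose `j`-fold block is the cover of a collar label is covered by `□_{j−1}`** (standing range `j ≤ m + K`; `1 ≤ j ≤ k`, `L ≤ ρ`).
[cite: Balaban1984PropagatorsI, (1.18) p.20; Balaban1985RegularSpaces, (1.131) p.99; Balaban1987RG1, (0.1) p.251] -/
theorem mem_image_cover_cube_pred_of_iterBlockOf_eq {a : Pt P.d} {M ρ k j : ℕ} (hj : j ≤ P.m + P.K) (hLρ : P.L ≤ ρ) (h1 : 1 ≤ j) (hjk : j ≤ k)
    {s : Pt P.d} (hs : InBox (sqLo P.L a ρ k j - 1) (sqHi P.L a M ρ k j + 1) s) {x : Site P 0} (hx : iterBlockOf j x = coverAt P j s) :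
    x ∈ cover P '' cube P.L a M ρ k (j - 1) := by
  have hmem : x ∈ iterBlock j (coverAt P j s) := (mem_iterBlock j _ x).2 hx
  rw [← image_cover_blockSites hj s, Finset.mem_image] at hmem
  obtain ⟨x', hx', rfl⟩ := hmem
  exact ⟨x', blockSites_collar_subset_cube_pred hLρ h1 hjk hs (Finset.mem_coe.2 hx'), rfl⟩

/-- ★ **Every `Λ_j`-cell of the levelwise meet `□ ⊓ D₂` (`1 ≤ j ≤ k`) has both endpoint labels in the collar box** `[sqLo_j − 1, sqHi_j + 1]`: one endpoint lies in
`Ω′_j ⊆ □_j^{(j)} = π_j '' [sqLo_j, sqHi_j]` ([4] (2.3) `Λ_j ⊂ Ω_j`), the other is its neighbour. [cite: Balaban1984PropagatorsII, (2.1)–(2.3) p.224; Balaban1985Variational, (150) p.301; Balaban1985RegularSpaces, (1.131) p.99] -/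
theorem exists_collar_labels_of_lamBond_meet {a : Pt P.d} {M ρ k : ℕ} {hk : k ≤ P.m + P.K} (D₂ : Domains P) {j : ℕ} (h1 : 1 ≤ j) (hjk : j ≤ k)
    {c : PBond P j} (hc : (domainsMeet (cubeDomains P a M ρ k hk) D₂).LamBond j c) :
    ∃ s s' : Pt P.d, c.src = coverAt P j s ∧ c.tgt = coverAt P j s' ∧
      InBox (sqLo P.L a ρ k j - 1) (sqHi P.L a M ρ k j + 1) s ∧ InBox (sqLo P.L a ρ k j - 1) (sqHi P.L a M ρ k j + 1) s' := by
  -- a label of `□_j^{(j)}` lies in the collar box, and so do its two neighbours in the bond's direction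
  have hstep : ∀ (t : Pt P.d) (i : Fin P.d), |(Pi.single c.dir (1 : ℤ) : Pt P.d) i| ≤ 1 := fun t i => by
    by_cases hi : i = c.dir
    · subst hi; simp
    · simp [Pi.single_eq_of_ne hi]
  have widen : ∀ {t : Pt P.d}, InBox (sqLo P.L a ρ k j) (sqHi P.L a M ρ k j) t →
      InBox (sqLo P.L a ρ k j - 1) (sqHi P.L a M ρ k j + 1) t ∧
      InBox (sqLo P.L a ρ k j - 1) (sqHi P.L a M ρ k j + 1) (t + Pi.single c.dir 1) ∧
      InBox (sqLo P.L a ρ k j - 1) (sqHi P.L a M ρ k j + 1) (t - Pi.single c.dir 1) := by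
    intro t ht
    refine ⟨fun i => ?_, fun i => ?_, fun i => ?_⟩
    · obtain ⟨hl, hh⟩ := ht i
      simp only [Pi.sub_apply, Pi.add_apply, Pi.one_apply]
      constructor <;> linarith
    · obtain ⟨hl, hh⟩ := ht i
      have h1' := (abs_le.1 (hstep t i)).1
      have h2' := (abs_le.1 (hstep t i)).2
      simp only [Pi.sub_apply, Pi.add_apply, Pi.one_apply]
      constructor <;> linarith
    · obtain ⟨hl, hh⟩ := ht i
      have h1' := (abs_le.1 (hstep t i)).1
      have h2' := (abs_le.1 (hstep t i)).2
      simp only [Pi.sub_apply, Pi.add_apply, Pi.one_apply]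
      constructor <;> linarith
  -- which endpoint is in `Ω′_j`?
  obtain ⟨hend, -, -⟩ := hc
  rw [domainsMeet_Om] at hend
  rcases hend with hsrc | htgt
  · obtain ⟨t, ht, hts⟩ := (mem_cubeDomains_Om_iff h1 hjk _).1 (Finset.mem_inter.1 hsrc).1
    refine ⟨t, t + Pi.single c.dir 1, hts.symm, ?_, (widen ht).1, (widen ht).2.1⟩
    rw [PBond.tgt, ← hts, coverAt_add_single]
  · obtain ⟨t, ht, hts⟩ := (mem_cubeDomains_Om_iff h1 hjk _).1 (Finset.mem_inter.1 htgt).1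
    refine ⟨t - Pi.single c.dir 1, t, ?_, hts.symm, (widen ht).2.2, (widen ht).1⟩
    -- `src = tgt − e_μ`: `π_j (t − e_μ) + e_μ = π_j t = tgt = src + e_μ`, and `shift μ` is injective
    have h' : (coverAt P j (t - Pi.single c.dir 1)).shift c.dir = c.src.shift c.dir := by
      rw [← coverAt_add_single, sub_add_cancel, hts]; rfl
    funext ν
    have := congrFun h' ν
    by_cases hν : ν = c.dir
    · subst hν
      have h2 : (coverAt P j (t - Pi.single c.dir 1)) c.dir + 1 = c.src c.dir + 1 := by simpa [Site.shift] using this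
      exact (add_right_cancel h2).symm
    · simpa [Site.shift, Function.update_of_ne hν] using this.symm

/-! ## §3  The far datum rows: `‖(Q_jA)(c)‖` is bounded by the letter on `□_{j−1}` -/

section Rows

open scoped Matrix.Norms.L2Operator

variable {W : Type*} [NormedAddCommGroup W] [NormedSpace ℝ W]

/-- ★★ **`‖(Q_jA)(c)‖ ≤ t` WHEN `‖A‖ ≤ t` UNDER `□_{j−1}`** for a cell `c` of level `1 ≤ j ≤ k` (`j ≤ m + K`) with endpoint labels in the collar box of `□_j^{(j)}`, `L ≤ ρ`: the block mean reads
fine bonds under the two endpoint blocks only, and those lie under `□_{j−1}`. [cite: Balaban1985Variational, (152) p.301, (155)–(157) p.302; Balaban1984PropagatorsI, (1.18) p.20; Balaban1985RegularSpaces, (1.131) p.99] -/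
theorem norm_bondAvgIter_le_of_letter_cube_pred {a : Pt P.d} {M ρ k j : ℕ} (hj : j ≤ P.m + P.K) (hLρ : P.L ≤ ρ) (h1 : 1 ≤ j) (hjk : j ≤ k)
    (A : PBond P 0 → W) {t : ℝ} (hA : ∀ b ∈ (Sect2.regionOfSet P (cover P '' cube P.L a M ρ k (j - 1))).bonds, ‖A b‖ ≤ t)
    (c : PBond P j) {s s' : Pt P.d} (hsrc : c.src = coverAt P j s) (htgt : c.tgt = coverAt P j s')
    (hs : InBox (sqLo P.L a ρ k j - 1) (sqHi P.L a M ρ k j + 1) s) (hs' : InBox (sqLo P.L a ρ k j - 1) (sqHi P.L a M ρ k j + 1) s') :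
    ‖bondAvgIter j A c‖ ≤ t := by
  refine norm_bondAvgIter_le_tower j hj {z | z = c.src ∨ z = c.tgt} A t (fun b hb1 hb2 => hA b ⟨?_, ?_⟩) c (Or.inl rfl) (Or.inr rfl)
  · simp only [Set.mem_setOf_eq, B6SectAOntoV1.blk_eq_iterBlockOf] at hb1
    rcases hb1 with h | h
    · exact mem_image_cover_cube_pred_of_iterBlockOf_eq hj hLρ h1 hjk hs (h.trans hsrc)
    · exact mem_image_cover_cube_pred_of_iterBlockOf_eq hj hLρ h1 hjk hs' (h.trans htgt)
  · simp only [Set.mem_setOf_eq, B6SectAOntoV1.blk_eq_iterBlockOf] at hb2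
    rcases hb2 with h | h
    · exact mem_image_cover_cube_pred_of_iterBlockOf_eq hj hLρ h1 hjk hs (h.trans hsrc)
    · exact mem_image_cover_cube_pred_of_iterBlockOf_eq hj hLρ h1 hjk hs' (h.trans htgt)

/-- ★★★ **THE FAR DATUM ROWS FROM THE TOWER LETTERS (152), AT THE CELLS OF PRINT's (150) FAMILY** ((156)–(157)'s block average in the top-level unit) — for every cell `c` of the levelwise meet `cubeDomains a M ρ k ⊓ D₂` of level
`1 ≤ j(c)`, the S3 door's (T2) row VERBATIM (HS3NORM-67c: `‖A b‖ < κ·ε·L^{k−j′}` on the fine bonds under `□_{j′}`, every `j′ ≤ k`) gives `‖bondAvgIter j(c) A c‖ ≤ κ·ε·L^{k − (j(c) − 1)}`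
(`L ≤ ρ`, `k ≤ m + K`). [cite: Balaban1985Variational, (152) p.301, (155)–(157) p.302; Balaban1984PropagatorsII, (2.3) p.224, (2.20) p.226; Balaban1985RegularSpaces, (1.131) p.99] -/
theorem norm_bondAvgIter_le_of_tower152_meet {a : Pt P.d} {M ρ k : ℕ} {hk : k ≤ P.m + P.K} (hLρ : P.L ≤ ρ) (D₂ : Domains P)
    (A : PBond P 0 → W) {κ ε : ℝ}
    (hT2 : ∀ j', j' ≤ k → ∀ b ∈ (Sect2.regionOfSet P (cover P '' cube P.L a M ρ k j')).bonds, ‖A b‖ < κ * ε * (P.L : ℝ) ^ (k - j'))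
    (c : BondIdx (domainsMeet (cubeDomains P a M ρ k hk) D₂)) (h1 : 1 ≤ (c.1.1 : ℕ)) :
    ‖bondAvgIter (c.1.1 : ℕ) A c.1.2‖ ≤ κ * ε * (P.L : ℝ) ^ (k - ((c.1.1 : ℕ) - 1)) := by
  have hjk : (c.1.1 : ℕ) ≤ k := by
    have h := c.1.1.2
    simp only [domainsMeet_k, cubeDomains_k] at h
    omega
  obtain ⟨s, s', hsrc, htgt, hs, hs'⟩ := exists_collar_labels_of_lamBond_meet D₂ h1 hjk c.2
  exact norm_bondAvgIter_le_of_letter_cube_pred (hjk.trans hk) hLρ h1 hjk A (fun b hb => (hT2 _ (by omega) b hb).le) c.1.2 hsrc htgt hs hs'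

/-- ★ The same in MODULE 77b's far-row shape (weight `L^{k − j(c)}`, the extra collar factor `L` moved into the constant): `‖bondAvgIter j(c) A c‖ ≤ (κ·L·ε)·L^{k − j(c)}`.
[cite: Balaban1985Variational, (152) p.301, (155)–(157) p.302] -/
theorem norm_bondAvgIter_le_of_tower152_meet_weighted {a : Pt P.d} {M ρ k : ℕ} {hk : k ≤ P.m + P.K} (hLρ : P.L ≤ ρ) (D₂ : Domains P)
    (A : PBond P 0 → W) {κ ε : ℝ}
    (hT2 : ∀ j', j' ≤ k → ∀ b ∈ (Sect2.regionOfSet P (cover P '' cube P.L a M ρ k j')).bonds, ‖A b‖ < κ * ε * (P.L : ℝ) ^ (k - j'))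
    (c : BondIdx (domainsMeet (cubeDomains P a M ρ k hk) D₂)) (h1 : 1 ≤ (c.1.1 : ℕ)) :
    ‖bondAvgIter (c.1.1 : ℕ) A c.1.2‖ ≤ κ * (P.L : ℝ) * ε * (P.L : ℝ) ^ (k - (c.1.1 : ℕ)) := by
  have hjk : (c.1.1 : ℕ) ≤ k := by
    have h := c.1.1.2
    simp only [domainsMeet_k, cubeDomains_k] at h
    omega
  have h := norm_bondAvgIter_le_of_tower152_meet hLρ D₂ A hT2 c h1
  have hpow : (P.L : ℝ) ^ (k - ((c.1.1 : ℕ) - 1)) = (P.L : ℝ) * (P.L : ℝ) ^ (k - (c.1.1 : ℕ)) := by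
    rw [← pow_succ', show k - (c.1.1 : ℕ) + 1 = k - ((c.1.1 : ℕ) - 1) by omega]
  rw [hpow] at h
  calc ‖bondAvgIter (c.1.1 : ℕ) A c.1.2‖ ≤ κ * ε * ((P.L : ℝ) * (P.L : ℝ) ^ (k - (c.1.1 : ℕ))) := h
    _ = κ * (P.L : ℝ) * ε * (P.L : ℝ) ^ (k - (c.1.1 : ℕ)) := by ring

/-- ★ **The level-0 far row on `□₀`**: a fine cell `c` (level `0`, `Q₀ = id`) with both endpoints under `□₀` is bounded by (T2) at `j′ = 0` directly: `‖A c‖ ≤ κ·ε·L^{k}`.  (Fine cells of the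
family beyond `□₀` are PINNED and beyond the stencil of the free region; there the chart takes `B c := 0`, MODULE 76.) [cite: Balaban1985Variational, (152) p.301, (155)–(157) p.302] -/
theorem norm_le_of_tower152_zero {a : Pt P.d} {M ρ k : ℕ} (A : PBond P 0 → W) {κ ε : ℝ}
    (hT2 : ∀ j', j' ≤ k → ∀ b ∈ (Sect2.regionOfSet P (cover P '' cube P.L a M ρ k j')).bonds, ‖A b‖ < κ * ε * (P.L : ℝ) ^ (k - j'))
    (c : PBond P 0) (hc : c ∈ (Sect2.regionOfSet P (cover P '' cube P.L a M ρ k 0)).bonds) :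
    ‖bondAvgIter 0 A c‖ ≤ κ * ε * (P.L : ℝ) ^ k := by
  have h := (hT2 0 (Nat.zero_le k) c hc).le
  rw [Nat.sub_zero] at h
  exact h

end Rows

end Summit.QuantumFields.YangMills.BalabanUVNodes.N07FarRowsOfTowerLetters

end
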